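import Summits.ResolutionOfSingularities.ResolutionOfSingularities.Theorems.WeightedInvariantSuccessorRatioBoundStability
import HarnessLib

/-!
# (o56)(b′) ring side, PART 3 of 6 — COMPETITOR FRAMES: contact below ratio `2` is rigid mod `𝔪²`; `successorRatioBound_of_frames`,
# `nonmem_of_representatives`, and the ring side from LOW WITNESSES `successorRatioBound_of_lowWitnesses`

**Provenance / honest framing.** This is a VERBATIM PORT (proofs unchanged; namespace `…LocalEngine.Iota3.RatContact` instead of the sketch's
`…Iota3.R9`) of res-L1-w43-idea-2's kernel-checked sketch `Cruxes/WeightedConstruction/SketchL1w43Idea2R9.lean` (Sketch-R9, gen 9, tree copy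
b7197eb188e64d8c = 657de2227c79926d + the §15 unit-factor lemma; §14e as announced f30a0aee35c844fc), board item (o56-R9) of res-L1-w43-plan-1 (dealer word STATUS l.69360), res-plan-2 IDLE POOL
DEAL #52 (2); ported by res-L1-type-o4 so that `Theorems/` files (res-type-057's (D1) bundle for the door item `stmt-ResolutionOfSingularities-19897`
branch (o56)(b′)) can import it; `--supports stmt-ResolutionOfSingularities-0571 --as helper`. [OURS · L1 w43 · idea-2 R9] Every statement here is OURS
elementary commutative algebra over Mathlib and the tree's `flagContactFiltration` / `weightedMonomialIdeal` / unit-expansion calculus; every `def` is an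
OURS notion of the sketch (NOT a statement of H. Hironaka's 2017 manuscript, which is under adjudication and is neither asserted nor used); no Literature
fact is introduced; AI-written and AI-ported, weaker than expert review; nothing here is progress on resolution of singularities in positive characteristic.

## Contents (Sketch-R9 §12, section `CompetitorFrame`, verbatim; its representatives block is in PART 2)
`layer_identity`, `span_triple_eq_of_isUnit`, `competitor_coefficients`, `span_eq_maximalIdeal_of_competitor`, `frame_of_layer`,
`oneFlagRatioBound_of_frames` / `successorRatioBound_of_frames`, `oneFlagRatioBound_of_lowWitnesses` / `successorRatioBound_of_lowWitnesses`
(+ `_rational`): the ring side of (o56)(b′) from the layer data and low witnesses.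
-/

noncomputable section

open IsLocalRing Literature.AlgebraicGeometry.Resolution

set_option linter.dupNamespace false

namespace Summit.ResolutionOfSingularities.ResolutionOfSingularities.Cruxes.HypersurfaceCentreConstruction.LocalEngine

namespace Iota3

namespace RatContact

universe u

section CompetitorFrame

variable {T : Type u} [CommRing T] [IsRegularLocalRing T]

open MvPolynomial in
/-- [OURS · R9] **Layer identity over the residue field.**  If `f ≡ Σ_{α∈Δ} a_α u^α (mod 𝔪^{ν+1})` with all `|α| = ν` and
`f ≡ Q(u) (mod 𝔪^{ν+1})` for a `ν`-form `Q`, then `Σ_α ā_α x^α = Q̄(x)` for every point `x` over the residue field (weighted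
quasi-regularity `coeff_layer_sub_mem_maximalIdeal` of the tree, weights `1`). [cite: Matsumura1987, Thm. 16.2] -/
theorem layer_identity (hdim : ringKrullDim T = (3 : ℕ)) {u : Fin 3 → T}
    (h𝔪 : Ideal.span (Set.range u) = maximalIdeal T) {ν : ℕ} {Δ : Finset (Fin 3 → ℕ)} {a : (Fin 3 → ℕ) → T}
    (hΔ : ∀ α ∈ Δ, ∑ i, α i = ν) {f : T} (hf : f - ∑ α ∈ Δ, a α * ∏ i, u i ^ α i ∈ maximalIdeal T ^ (ν + 1))
    (Q : MvPolynomial (Fin 3) T) (hQ : Q.IsWeightedHomogeneous (fun _ : Fin 3 => (1 : ℕ)) ν)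
    (hfQ : f - eval u Q ∈ maximalIdeal T ^ (ν + 1)) (x : Fin 3 → IsLocalRing.ResidueField T) :
    ∑ α ∈ Δ, IsLocalRing.residue T (a α) * ∏ i, x i ^ α i =
      eval x (MvPolynomial.map (IsLocalRing.residue T) Q) := by
  classical
  have hw : ∀ i : Fin 3, 0 < (fun _ : Fin 3 => (1 : ℕ)) i := fun _ => one_pos
  have hge : ∀ α ∈ Δ, ν ≤ ∑ i, (fun _ : Fin 3 => (1 : ℕ)) i * α i := by
    intro α hα
    simp only [one_mul]
    exact (hΔ α hα).ge
  have hfQ' : f - eval u Q ∈ weightedMonomialIdeal u (fun _ : Fin 3 => (1 : ℕ)) (ν + 1) := by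
    rwa [Theorems.LocalGameEFTNewton.weightedMonomialIdeal_const_one_eq_pow u h𝔪 (ν + 1)]
  have key := Theorems.LocalGameEFTNewton.coeff_layer_sub_mem_maximalIdeal u h𝔪 hdim (fun _ : Fin 3 => (1 : ℕ)) hw
    hf hge (Nat.lt_succ_self ν) Q hQ hfQ'
  have hfilter : Δ.filter (fun α => ∑ i, (fun _ : Fin 3 => (1 : ℕ)) i * α i = ν) = Δ := by
    refine Finset.filter_true_of_mem fun α hα => ?_
    simp only [one_mul]
    exact hΔ α hα
  rw [hfilter] at key
  have hP0 : MvPolynomial.map (IsLocalRing.residue T)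
      (∑ α ∈ Δ, monomial (Finsupp.equivFunOnFinite.symm α) (a α) - Q) = 0 := by
    ext β
    rw [coeff_map, coeff_zero]
    exact (IsLocalRing.residue_eq_zero_iff _).mpr (key β)
  have h0 := congrArg (MvPolynomial.eval x) hP0
  simp only [map_sub, map_sum, map_monomial, map_zero, sub_eq_zero,
    Theorems.LocalGameEFTNewton.eval_monomial_equivFunOnFinite_symm] at h0
  exact h0

omit [IsRegularLocalRing T] in
/-- [OURS · R9] **Frames**: `(t, z, αt + βz + γY)` and `(t, z, Y)` generate the same ideal when `γ` is a unit. [folklore] -/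
theorem span_triple_eq_of_isUnit {t z Y α β γ : T} (hγ : IsUnit γ) :
    Ideal.span (Set.range ![t, z, α * t + β * z + γ * Y]) = Ideal.span (Set.range ![t, z, Y]) := by
  obtain ⟨w, rfl⟩ := hγ
  set ℓ := α * t + β * z + ↑w * Y with hℓ_def
  have ht : t ∈ Ideal.span (Set.range ![t, z, Y]) := Ideal.subset_span ⟨0, rfl⟩
  have hz : z ∈ Ideal.span (Set.range ![t, z, Y]) := Ideal.subset_span ⟨1, rfl⟩
  have hY : Y ∈ Ideal.span (Set.range ![t, z, Y]) := Ideal.subset_span ⟨2, rfl⟩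
  have ht' : t ∈ Ideal.span (Set.range ![t, z, ℓ]) := Ideal.subset_span ⟨0, rfl⟩
  have hz' : z ∈ Ideal.span (Set.range ![t, z, ℓ]) := Ideal.subset_span ⟨1, rfl⟩
  have hℓ' : ℓ ∈ Ideal.span (Set.range ![t, z, ℓ]) := Ideal.subset_span ⟨2, rfl⟩
  have hℓ : ℓ ∈ Ideal.span (Set.range ![t, z, Y]) :=
    Ideal.add_mem _ (Ideal.add_mem _ (Ideal.mul_mem_left _ _ ht) (Ideal.mul_mem_left _ _ hz))
      (Ideal.mul_mem_left _ _ hY)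
  have hY' : Y ∈ Ideal.span (Set.range ![t, z, ℓ]) := by
    have : Y = ↑w⁻¹ * (ℓ - α * t - β * z) := by
      rw [show ℓ - α * t - β * z = ↑w * Y by rw [hℓ_def]; ring, Units.inv_mul_cancel_left]
    rw [this]
    exact Ideal.mul_mem_left _ _
      (Ideal.sub_mem _ (Ideal.sub_mem _ hℓ' (Ideal.mul_mem_left _ _ ht')) (Ideal.mul_mem_left _ _ hz'))
  apply le_antisymm
  · rw [Ideal.span_le]
    rintro x ⟨i, rfl⟩
    fin_cases i
    · simpa using ht
    · simpa using hz
    · simpa using hℓ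
  · rw [Ideal.span_le]
    rintro x ⟨i, rfl⟩
    fin_cases i
    · simpa using ht'
    · simpa using hz'
    · simpa using hY'

open MvPolynomial in
/-- [OURS · R9] **A competitor of ratio > 1 is `αt + βz + γY` with `γ` a UNIT and `β ∈ 𝔪`.**  Regular local, dim 3, frame `(t,z,Y)`;
the degree-`ν` layer of `f` is `Σ_{α∈Δ} a_α u^α` (`|α| = ν`) with a UNIT coefficient at `Y^ν` and every other layer monomial divisible by
`t` (`htfree` — at the CURVE° successor every non-`Y^ν` monomial of `f₁` has `t`-exponent `i − b(ν−j) ≥ 1` because `r > qb`); if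
`f ≡ c·g^ν (mod 𝔪^{ν+1})` with `g ∈ 𝔪` (what §3 extracts from any competitor of ratio `> 1`), then `g = αt + βz + γY` with `γ` a unit
and `β ∈ 𝔪` (NO `z̄`-component).  Proof: the layer identity at `(0,0,1)` gives `ā_{(0,0,ν)} = c̄·γ̄^ν`, at `(0,1,0)` gives `0 = c̄·β̄^ν`.
[cite: Matsumura1987, Thm. 16.2] -/
theorem competitor_coefficients (hdim : ringKrullDim T = (3 : ℕ)) {t z Y f g : T}
    (h𝔪 : Ideal.span (Set.range ![t, z, Y]) = maximalIdeal T) {ν : ℕ} (hν : 0 < ν)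
    {Δ : Finset (Fin 3 → ℕ)} {a : (Fin 3 → ℕ) → T} (hΔ : ∀ α ∈ Δ, ∑ i, α i = ν)
    (hα₀ : (![0, 0, ν] : Fin 3 → ℕ) ∈ Δ) (ha₀ : IsUnit (a ![0, 0, ν]))
    (htfree : ∀ α ∈ Δ, α 0 = 0 → α = ![0, 0, ν])
    (hf : f - ∑ α ∈ Δ, a α * ∏ i, ![t, z, Y] i ^ α i ∈ maximalIdeal T ^ (ν + 1))
    (hg : g ∈ maximalIdeal T) {c : T} (h : f - c * g ^ ν ∈ maximalIdeal T ^ (ν + 1)) :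
    ∃ α β γ : T, IsUnit γ ∧ β ∈ maximalIdeal T ∧ g = α * t + β * z + γ * Y := by
  classical
  set u : Fin 3 → T := ![t, z, Y] with hu_def
  have hg' : g ∈ Ideal.span (Set.range u) := by rw [h𝔪]; exact hg
  obtain ⟨cf, hcf⟩ := Ideal.mem_span_range_iff_exists_fun.mp hg'
  set L : MvPolynomial (Fin 3) T := ∑ i, C (cf i) * X i with hL_def
  set Q : MvPolynomial (Fin 3) T := C c * L ^ ν with hQ_def
  have hLeval : eval u L = g := by
    simp only [hL_def, map_sum, map_mul, eval_C, eval_X]; exact hcf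
  have hQeval : eval u Q = c * g ^ ν := by
    simp only [hQ_def, map_mul, map_pow, eval_C, hLeval]
  have hLhom : L.IsWeightedHomogeneous (fun _ : Fin 3 => (1 : ℕ)) 1 := by
    refine IsWeightedHomogeneous.sum Finset.univ (fun i => C (cf i) * X i) 1 (fun i _ => ?_)
    simpa using (isWeightedHomogeneous_C (fun _ : Fin 3 => (1 : ℕ)) (cf i)).mul
      (isWeightedHomogeneous_X T (fun _ : Fin 3 => (1 : ℕ)) i)
  have hQhom : Q.IsWeightedHomogeneous (fun _ : Fin 3 => (1 : ℕ)) ν := by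
    simpa using (isWeightedHomogeneous_C (fun _ : Fin 3 => (1 : ℕ)) c).mul (hLhom.pow ν)
  have hfQ : f - eval u Q ∈ maximalIdeal T ^ (ν + 1) := by rw [hQeval]; exact h
  set r := IsLocalRing.residue T with hr_def
  have hev := layer_identity hdim h𝔪 hΔ hf Q hQhom hfQ ![0, 0, 1]
  -- the left-hand side collapses to `r (a (0,0,ν))`
  have hlhs : ∑ α ∈ Δ, r (a α) * ∏ i, (![0, 0, 1] : Fin 3 → IsLocalRing.ResidueField T) i ^ α i
      = r (a ![0, 0, ν]) := by
    rw [Finset.sum_eq_single_of_mem _ hα₀]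
    · simp [Fin.prod_univ_three]
    · intro α hα hne
      have hsum := hΔ α hα
      have hpos : α 0 ≠ 0 ∨ α 1 ≠ 0 := by
        by_contra hcon
        rw [not_or, not_ne_iff, not_ne_iff] at hcon
        apply hne
        funext i
        fin_cases i
        · simp [hcon.1]
        · simp [hcon.2]
        · simp only [Fin.sum_univ_three, hcon.1, hcon.2, zero_add] at hsum
          simp [hsum]
      rcases hpos with h0 | h1
      · simp [Fin.prod_univ_three, zero_pow h0]
      · simp [Fin.prod_univ_three, zero_pow h1]
  -- the right-hand side is `r c * (r (cf 2))^ν`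
  have hrhs : eval (![0, 0, 1] : Fin 3 → IsLocalRing.ResidueField T) (MvPolynomial.map r Q) = r c * r (cf 2) ^ ν := by
    simp [hQ_def, hL_def, map_mul, map_pow, map_C, map_X, eval_C, eval_X, Fin.sum_univ_three]
  rw [hlhs, hrhs] at hev
  have hcf2 : IsUnit (cf 2) := by
    rw [← IsLocalRing.residue_ne_zero_iff_isUnit]
    intro h2
    rw [h2, zero_pow hν.ne', mul_zero] at hev
    exact (ha₀.map r).ne_zero hev
  have hrc : r c ≠ 0 := by
    intro h0
    rw [h0, zero_mul] at hev
    exact (ha₀.map r).ne_zero hev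
  -- evaluate at `(0,1,0)`: every layer monomial vanishes there (`Y^ν` since `ν > 0`, the others contain `t`)
  have hev1 := layer_identity hdim h𝔪 hΔ hf Q hQhom hfQ ![0, 1, 0]
  have hlhs1 : ∑ α ∈ Δ, r (a α) * ∏ i, (![0, 1, 0] : Fin 3 → IsLocalRing.ResidueField T) i ^ α i = 0 := by
    refine Finset.sum_eq_zero fun α hα => ?_
    by_cases h0 : α 0 = 0
    · have hα := htfree α hα h0
      subst hα
      simp [Fin.prod_univ_three, zero_pow hν.ne']
    · simp [Fin.prod_univ_three, zero_pow h0]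
  have hrhs1 : eval (![0, 1, 0] : Fin 3 → IsLocalRing.ResidueField T) (MvPolynomial.map r Q) = r c * r (cf 1) ^ ν := by
    simp [hQ_def, hL_def, map_mul, map_pow, map_C, map_X, eval_C, eval_X, Fin.sum_univ_three]
  rw [hlhs1, hrhs1] at hev1
  have hcf1 : cf 1 ∈ maximalIdeal T := by
    rw [← IsLocalRing.residue_eq_zero_iff]
    rcases mul_eq_zero.mp hev1.symm with h0 | h0
    · exact absurd h0 hrc
    · exact (pow_eq_zero_iff hν.ne').mp h0
  refine ⟨cf 0, cf 1, cf 2, hcf2, hcf1, ?_⟩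
  have := hcf
  simp only [hu_def, Fin.sum_univ_three, Matrix.cons_val_zero, Matrix.cons_val_one, Matrix.cons_val_two,
    Matrix.tail_cons, Matrix.head_cons] at this
  linear_combination (-1 : T) * this

/-- [OURS · R9] Corollary: such a competitor completes `(t, z)` to a frame. [folklore] -/
theorem span_eq_maximalIdeal_of_competitor (hdim : ringKrullDim T = (3 : ℕ)) {t z Y f g : T}
    (h𝔪 : Ideal.span (Set.range ![t, z, Y]) = maximalIdeal T) {ν : ℕ} (hν : 0 < ν)
    {Δ : Finset (Fin 3 → ℕ)} {a : (Fin 3 → ℕ) → T} (hΔ : ∀ α ∈ Δ, ∑ i, α i = ν)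
    (hα₀ : (![0, 0, ν] : Fin 3 → ℕ) ∈ Δ) (ha₀ : IsUnit (a ![0, 0, ν]))
    (htfree : ∀ α ∈ Δ, α 0 = 0 → α = ![0, 0, ν])
    (hf : f - ∑ α ∈ Δ, a α * ∏ i, ![t, z, Y] i ^ α i ∈ maximalIdeal T ^ (ν + 1))
    (hg : g ∈ maximalIdeal T) {c : T} (h : f - c * g ^ ν ∈ maximalIdeal T ^ (ν + 1)) :
    Ideal.span (Set.range ![t, z, g]) = maximalIdeal T := by
  obtain ⟨α, β, γ, hγ, -, rfl⟩ := competitor_coefficients hdim h𝔪 hν hΔ hα₀ ha₀ htfree hf hg h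
  rw [span_triple_eq_of_isUnit hγ, h𝔪]

/-- [OURS · R9] The frame property in the form the reduction consumes: every `g ∈ 𝔪` along which `f` has rational contact of some
ratio `a/b > 1` is `αt + βz + γY` with `γ` a unit and `β ∈ 𝔪` (§3 dichotomy + `competitor_coefficients`). [folklore] -/
theorem frame_of_layer (hdim : ringKrullDim T = (3 : ℕ)) {t z Y f : T}
    (h𝔪 : Ideal.span (Set.range ![t, z, Y]) = maximalIdeal T) {ν : ℕ} (hν : 0 < ν)
    {Δ : Finset (Fin 3 → ℕ)} {a : (Fin 3 → ℕ) → T} (hΔ : ∀ α ∈ Δ, ∑ i, α i = ν)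
    (hα₀ : (![0, 0, ν] : Fin 3 → ℕ) ∈ Δ) (ha₀ : IsUnit (a ![0, 0, ν]))
    (htfree : ∀ α ∈ Δ, α 0 = 0 → α = ![0, 0, ν])
    (hf : f - ∑ α ∈ Δ, a α * ∏ i, ![t, z, Y] i ^ α i ∈ maximalIdeal T ^ (ν + 1)) :
    ∀ g ∈ maximalIdeal T, ∀ a' b' : ℕ, 0 < b' → b' < a' →
      f ∈ ratContactFiltration g a' b' (a' * ν) →
        ∃ α β γ : T, IsUnit γ ∧ β ∈ maximalIdeal T ∧ g = α * t + β * z + γ * Y := by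
  intro g hg a' b' hb' hab hmem
  obtain ⟨c, hc⟩ := exists_sub_mul_pow_mem_of_mem_ratContactFiltration hg hb' hab hmem
  exact competitor_coefficients hdim h𝔪 hν hΔ hα₀ ha₀ htfree hf hg hc

/-- [OURS · R9 · (b′) ABSTRACT REDUCTION] **`SuccessorRatioBound` from frames and weighted non-membership.**  With slope budget
`K = 1 + ρ/q` (`0 < ρ < q`): if every competitor of ratio `> 1` is `αt + βz + γY` with `γ` a unit, `β ∈ 𝔪` (`hframe`, = `frame_of_layer`) and `f`
lies in NO `RC(αt+βz+γY; a, b; aν)` with `γ` a unit, `β ∈ 𝔪`, `(q+ρ)·b ≤ a·q` (ratio `≥ K`) and `a ≤ 2b` (ratio `≤ 2`), then EVERY two-flag reaches only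
ratios `< K`.  Ratios `> 2` are folded onto `(a,b) = (2,1)` by `ratContactFiltration_mono_ratio`; by §11 (`N = 2`, `a ≤ 2b`) the
hypothesis `hW` only ever needs the linear form up to `𝔪²` (`nonmem_of_rational` below). [folklore] -/
theorem oneFlagRatioBound_of_frames {t z Y f : T} {ν q ρ : ℕ} (hρ : 0 < ρ) (hρq : ρ < q)
    (hframe : ∀ g ∈ maximalIdeal T, ∀ a b : ℕ, 0 < b → b < a →
      f ∈ ratContactFiltration g a b (a * ν) → ∃ α β γ : T, IsUnit γ ∧ β ∈ maximalIdeal T ∧ g = α * t + β * z + γ * Y)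
    (hW : ∀ α β γ : T, IsUnit γ → β ∈ maximalIdeal T → ∀ a b : ℕ, 0 < b →
      (q + ρ) * b ≤ a * q → a ≤ 2 * b → f ∉ ratContactFiltration (α * t + β * z + γ * Y) a b (a * ν)) :
    OneFlagRatioBound T f ν q ρ := by
  intro g hg𝔪 r₁ r₂ hr₂ _ hmem
  refine Nat.lt_of_not_le fun hge => ?_
  -- the claimed ratio exceeds 1
  have hlt : r₂ < r₁ := by
    refine Nat.lt_of_not_le fun hle => ?_
    have h1 : r₁ * q ≤ r₂ * q := Nat.mul_le_mul_right _ hle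
    have h2 : (q + ρ) * r₂ = r₂ * q + ρ * r₂ := by ring
    have h3 : 0 < ρ * r₂ := Nat.mul_pos hρ hr₂
    omega
  by_cases h2 : r₁ ≤ 2 * r₂
  · obtain ⟨α, β, γ, hγ, hβ, rfl⟩ := hframe g hg𝔪 r₁ r₂ hr₂ hlt hmem
    exact hW α β γ hγ hβ r₁ r₂ hr₂ hge h2 hmem
  · have h2' : 2 * r₂ < r₁ := Nat.lt_of_not_le h2
    have hmem2 : f ∈ ratContactFiltration g 2 1 (2 * ν) :=
      ratContactFiltration_mono_ratio hr₂ one_pos (by omega) ν hmem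
    obtain ⟨α, β, γ, hγ, hβ, rfl⟩ := hframe g hg𝔪 2 1 one_pos one_lt_two hmem2
    exact hW α β γ hγ hβ 2 1 one_pos (by omega) (by norm_num) hmem2

/-- The two-flag (`σ₁`) form of `oneFlagRatioBound_of_frames` (kept under its name of record). [folklore] -/
theorem successorRatioBound_of_frames {t z Y f : T} {ν q ρ : ℕ} (hρ : 0 < ρ) (hρq : ρ < q)
    (hframe : ∀ g ∈ maximalIdeal T, ∀ a b : ℕ, 0 < b → b < a →
      f ∈ ratContactFiltration g a b (a * ν) → ∃ α β γ : T, IsUnit γ ∧ β ∈ maximalIdeal T ∧ g = α * t + β * z + γ * Y)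
    (hW : ∀ α β γ : T, IsUnit γ → β ∈ maximalIdeal T → ∀ a b : ℕ, 0 < b →
      (q + ρ) * b ≤ a * q → a ≤ 2 * b → f ∉ ratContactFiltration (α * t + β * z + γ * Y) a b (a * ν)) :
    SuccessorRatioBound T f ν q ρ :=
  (oneFlagRatioBound_of_frames hρ hρq hframe hW).successorRatioBound

/-- [OURS · R9 · (b′) RING-SIDE, ASSEMBLED] **`SuccessorRatioBound` from LOW UNIT MONOMIALS IN THE TRANSLATED FRAMES.**  Regular local
ring of dimension `3` whose residue classes have representatives in `Λ ⊆ T` (every closed point: `Λ = k` at a `k`-rational point, polynomials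
in `z` of low degree at a non-rational closed point of the curve), frame `(t, z, Y)`, `0 < ρ < q`, `0 < ν`; the degree-`ν` layer of `f` has a
unit at `Y^ν` and every other layer monomial divisible by `t`; and for every representative `c ∈ Λ` and every ratio `A/B ∈ [K, 2]` some unit
expansion of `f` in the frame `(t, z, Y − c·t)` (for the door: the blow-up of the `S`-frame `(x, y − c·x^{b+1}, z)`, which keeps
`W((x,y,z);(q,r+1,1);·)` by the tree's jets lemma `Theorems.weightedMonomialIdeal_eq_of_forall_sub_mem`, so the `τ(η) = 0` witness transports)
carries a monomial of `(t,z)`-value `< K` (`witness_lands_low`, §5).  THEN every admissible triple reached by `f` has `r₁·q < (q+ρ)·r₂` — the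
ring side of (o56)(b′), with NO implicit-function / completion / Weierstrass / coefficient-field step: one-flag collapse (§2), dichotomy (§3),
layer identity (§12), `𝔪²`-rigidity below ratio 2 (§11), ratio monotonicity, frame identification (§6) and the monomial reading (§8). [folklore] -/
theorem oneFlagRatioBound_of_lowWitnesses (Λ : Set T)
    (hres : ∀ x : T, ∃ a ∈ Λ, x - a ∈ maximalIdeal T)
    (hdim : ringKrullDim T = (3 : ℕ)) {t z Y f : T} (h𝔪 : Ideal.span (Set.range ![t, z, Y]) = maximalIdeal T)
    {ν q ρ : ℕ} (hν : 0 < ν) (hρ : 0 < ρ) (hρq : ρ < q)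
    {Δ : Finset (Fin 3 → ℕ)} {a : (Fin 3 → ℕ) → T} (hΔ : ∀ α ∈ Δ, ∑ i, α i = ν)
    (hα₀ : (![0, 0, ν] : Fin 3 → ℕ) ∈ Δ) (ha₀ : IsUnit (a ![0, 0, ν]))
    (htfree : ∀ α ∈ Δ, α 0 = 0 → α = ![0, 0, ν])
    (hf : f - ∑ α ∈ Δ, a α * ∏ i, ![t, z, Y] i ^ α i ∈ maximalIdeal T ^ (ν + 1))
    (hWit : ∀ c ∈ Λ, ∀ A B : ℕ, 0 < B → (q + ρ) * B ≤ A * q → A ≤ 2 * B →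
      ∃ (Δ' : Finset (Fin 3 → ℕ)) (c' : (Fin 3 → ℕ) → T) (N : ℕ), (∀ e ∈ Δ', IsUnit (c' e)) ∧ A * ν ≤ N ∧
        f - ∑ e ∈ Δ', c' e * ∏ i, ![t, z, Y - c * t] i ^ e i ∈ maximalIdeal T ^ N ∧
        ∃ e ∈ Δ', q * (e 0 + e 1) < (q + ρ) * (ν - e 2)) :
    OneFlagRatioBound T f ν q ρ := by
  have hq : 0 < q := lt_of_le_of_lt (Nat.zero_le _) hρq
  have ht : t ∈ maximalIdeal T := by
    simpa using Theorems.LocalGameEFTNewton.mem_maximalIdeal_of_span_eq ![t, z, Y] h𝔪 0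
  have hz : z ∈ maximalIdeal T := by
    simpa using Theorems.LocalGameEFTNewton.mem_maximalIdeal_of_span_eq ![t, z, Y] h𝔪 1
  refine oneFlagRatioBound_of_frames hρ hρq (frame_of_layer hdim h𝔪 hν hΔ hα₀ ha₀ htfree hf)
    (nonmem_of_representatives Λ hres ht hz fun c hc A B hB hK h2 hmem => ?_)
  obtain ⟨Δ', c', N, hunit, hN, hr, e, he, hlow⟩ := hWit c hc A B hB hK h2
  -- the translated frame `(t, z, Y − c t)`
  have h𝔪' : Ideal.span (Set.range ![t, z, Y - c * t]) = maximalIdeal T := by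
    have h1 := span_triple_eq_of_isUnit (t := t) (z := z) (Y := Y) (α := -c) (β := 0) isUnit_one
    rw [show -c * t + 0 * z + 1 * Y = Y - c * t by ring] at h1
    rw [h1, h𝔪]
  have hBA : B ≤ A := by
    refine Nat.le_of_not_lt fun hlt => ?_
    have h1 : A * q < B * q := Nat.mul_lt_mul_of_pos_right hlt hq
    have h2 : B * q ≤ (q + ρ) * B := by
      calc B * q = q * B := by ring
        _ ≤ (q + ρ) * B := Nat.mul_le_mul_right _ (Nat.le_add_right q ρ)
    omega
  have hA : 0 < A := lt_of_lt_of_le hB hBA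
  have h𝔪'' : Ideal.span {t, z, Y - c * t} = maximalIdeal T := by
    rw [← range_vec₃]; exact h𝔪'
  rw [← weightedMonomialIdeal_eq_ratContactFiltration h𝔪'' hB hBA] at hmem
  have hge := (mem_weightedMonomialIdeal_iff_forall_le_weight hdim h𝔪' hB hA hunit hr hN).mp hmem e he
  exact absurd hge (not_le.mpr (low_weight hq hB hK hlow))

/-- The two-flag (`σ₁`) form of `oneFlagRatioBound_of_lowWitnesses` (kept under its name of record). [folklore] -/
theorem successorRatioBound_of_lowWitnesses (Λ : Set T)
    (hres : ∀ x : T, ∃ a ∈ Λ, x - a ∈ maximalIdeal T)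
    (hdim : ringKrullDim T = (3 : ℕ)) {t z Y f : T} (h𝔪 : Ideal.span (Set.range ![t, z, Y]) = maximalIdeal T)
    {ν q ρ : ℕ} (hν : 0 < ν) (hρ : 0 < ρ) (hρq : ρ < q)
    {Δ : Finset (Fin 3 → ℕ)} {a : (Fin 3 → ℕ) → T} (hΔ : ∀ α ∈ Δ, ∑ i, α i = ν)
    (hα₀ : (![0, 0, ν] : Fin 3 → ℕ) ∈ Δ) (ha₀ : IsUnit (a ![0, 0, ν]))
    (htfree : ∀ α ∈ Δ, α 0 = 0 → α = ![0, 0, ν])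
    (hf : f - ∑ α ∈ Δ, a α * ∏ i, ![t, z, Y] i ^ α i ∈ maximalIdeal T ^ (ν + 1))
    (hWit : ∀ c ∈ Λ, ∀ A B : ℕ, 0 < B → (q + ρ) * B ≤ A * q → A ≤ 2 * B →
      ∃ (Δ' : Finset (Fin 3 → ℕ)) (c' : (Fin 3 → ℕ) → T) (N : ℕ), (∀ e ∈ Δ', IsUnit (c' e)) ∧ A * ν ≤ N ∧
        f - ∑ e ∈ Δ', c' e * ∏ i, ![t, z, Y - c * t] i ^ e i ∈ maximalIdeal T ^ N ∧
        ∃ e ∈ Δ', q * (e 0 + e 1) < (q + ρ) * (ν - e 2)) :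
    SuccessorRatioBound T f ν q ρ :=
  (oneFlagRatioBound_of_lowWitnesses Λ hres hdim h𝔪 hν hρ hρq hΔ hα₀ ha₀ htfree hf hWit).successorRatioBound

/-- [OURS · R9 · (b′) RING-SIDE at a `k`-RATIONAL point] The same with a coefficient field: `T` a `k`-algebra in which every element is a
constant mod `𝔪`, witnesses for the constant translates `Y − c·t`, `c ∈ k`. [folklore] -/
theorem successorRatioBound_of_lowWitnesses_rational {k : Type*} [Field k] [Algebra k T]
    (hres : ∀ x : T, ∃ a : k, x - algebraMap k T a ∈ maximalIdeal T)
    (hdim : ringKrullDim T = (3 : ℕ)) {t z Y f : T} (h𝔪 : Ideal.span (Set.range ![t, z, Y]) = maximalIdeal T)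
    {ν q ρ : ℕ} (hν : 0 < ν) (hρ : 0 < ρ) (hρq : ρ < q)
    {Δ : Finset (Fin 3 → ℕ)} {a : (Fin 3 → ℕ) → T} (hΔ : ∀ α ∈ Δ, ∑ i, α i = ν)
    (hα₀ : (![0, 0, ν] : Fin 3 → ℕ) ∈ Δ) (ha₀ : IsUnit (a ![0, 0, ν]))
    (htfree : ∀ α ∈ Δ, α 0 = 0 → α = ![0, 0, ν])
    (hf : f - ∑ α ∈ Δ, a α * ∏ i, ![t, z, Y] i ^ α i ∈ maximalIdeal T ^ (ν + 1))
    (hWit : ∀ c : k, ∀ A B : ℕ, 0 < B → (q + ρ) * B ≤ A * q → A ≤ 2 * B →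
      ∃ (Δ' : Finset (Fin 3 → ℕ)) (c' : (Fin 3 → ℕ) → T) (N : ℕ), (∀ e ∈ Δ', IsUnit (c' e)) ∧ A * ν ≤ N ∧
        f - ∑ e ∈ Δ', c' e * ∏ i, ![t, z, Y - algebraMap k T c * t] i ^ e i ∈ maximalIdeal T ^ N ∧
        ∃ e ∈ Δ', q * (e 0 + e 1) < (q + ρ) * (ν - e 2)) :
    SuccessorRatioBound T f ν q ρ := by
  refine successorRatioBound_of_lowWitnesses (Set.range (algebraMap k T)) (fun x => ?_) hdim h𝔪 hν hρ hρq hΔ hα₀ ha₀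
    htfree hf ?_
  · obtain ⟨c, hc⟩ := hres x
    exact ⟨_, ⟨c, rfl⟩, hc⟩
  · rintro _ ⟨c, rfl⟩ A B hB hK h2
    exact hWit c A B hB hK h2

end CompetitorFrame

end RatContact

end Iota3

end Summit.ResolutionOfSingularities.ResolutionOfSingularities.Cruxes.HypersurfaceCentreConstruction.LocalEngine
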